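import Summits.Parity.GeneralizedHardyLittlewood.Theorems.DilatedTableChowla.Negative.DilatedTableChowlaScale

/-!
# `DilatedTableChowla` (stmt-Parity-14271): the table statements are FALSE for every periodic model of `λ`

Negative lemmas for the crux `LiouvilleShiftedTables.DilatedTableChowla` (route LiouvilleShiftedTables, X1; cdisprove seat), landed verbatim from the crux work file `Cruxes/DilatedTableChowla/Disproof.lean` (§7 there) so that skeletons, ideators and provers can import them.  Notation (`rows`, `cols`, `S`, `F`, `lhs`, `crux_iff_lhs`) from `DilatedTableChowlaBlocks`. [folklore]
-/

namespace Summit.Parity.GeneralizedHardyLittlewood.Theorems.DilatedTableChowla.Negative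

open Summit.Parity.GeneralizedHardyLittlewood.Theses.LiouvilleShiftedTables
open Finset

/-! ## §7 (d) λ-SENSITIVITY: the table statements are FALSE for every periodic model of λ

For ANY `m`-periodic `f : ℕ → ℝ` with `f 1 = 1` — every real Dirichlet character (principal or
not, e.g. `χ₃`, `χ₄`, the Kronecker symbols), every periodic `±1` pattern — the `q = 1` table
statement (hence the dilated one) is false: the rows `a ≡ 0 (mod m)` see the constant entry
`f(ab+1) = f(1) = 1`, so `Σ_{a,a'} S² ≥ (#rows₀)² #cols² ≈ x²/m²`. Any proof must therefore use the
APERIODICITY of λ quantitatively (a `(log x)^{-C}` saving needs non-pretentiousness uniformly in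
conductors up to the relevant range) — the formal content of the "Siegel-exceptional class" worry. -/

/-- The two-row correlation for a general entry function `f` in place of `λ`. -/
noncomputable def SF (f : ℕ → ℝ) (c : ℤ) (x A : ℝ) (q v a a' : ℕ) : ℝ :=
  ∑ b ∈ cols x A q v, f (Int.toNat ((a : ℤ) * b + c)) * f (Int.toNat ((a' : ℤ) * b + c))

/-- The fourth moment for a general entry function. -/
noncomputable def FF (f : ℕ → ℝ) (c : ℤ) (x A : ℝ) (q u v : ℕ) : ℝ :=
  ∑ a ∈ rows A q u, ∑ a' ∈ rows A q u, (SF f c x A q v a a') ^ 2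

/-- The crux functional for a general entry function. -/
noncomputable def lhsF (f : ℕ → ℝ) (c : ℤ) (δ x A : ℝ) (u v : ℕ → ℕ) : ℝ :=
  ∑ q ∈ Finset.Icc 1 ⌊x ^ (δ / 2)⌋₊, (q : ℝ) ^ 3 * FF f c x A q (u q) (v q)

/-- `DilatedTableChowla` with `λ` replaced by an arbitrary `f : ℕ → ℝ`. -/
def DilatedTableChowlaFor (f : ℕ → ℝ) : Prop :=
  ∀ c : ℤ, c ≠ 0 → ∀ δ : ℝ, 0 < δ → δ ≤ 1 / 12 → ∀ C : ℝ, 0 < C → ∃ x₀ : ℝ, ∀ x : ℝ, x₀ ≤ x →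
    ∀ A : ℝ, x ^ δ ≤ A → A ≤ x ^ (1 / 3 + δ) → ∀ u v : ℕ → ℕ,
      lhsF f c δ x A u v ≤ x ^ 2 / Real.log x ^ C

/-- `TableChowla` (stmt-Parity-14270) with `λ` replaced by an arbitrary `f : ℕ → ℝ`. -/
def TableChowlaFor (f : ℕ → ℝ) : Prop :=
  ∀ c : ℤ, c ≠ 0 → ∀ δ : ℝ, 0 < δ → δ ≤ 1 / 12 → ∀ C : ℝ, 0 < C → ∃ x₀ : ℝ, ∀ x : ℝ, x₀ ≤ x →
    ∀ A : ℝ, x ^ δ ≤ A → A ≤ x ^ (1 / 3 + δ) →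
      (∑ a ∈ Finset.Ioc ⌊A⌋₊ ⌊2 * A⌋₊, ∑ a' ∈ Finset.Ioc ⌊A⌋₊ ⌊2 * A⌋₊,
        (∑ b ∈ Finset.Icc 1 ⌊x / A⌋₊, f (Int.toNat ((a : ℤ) * b + c)) * f (Int.toNat ((a' : ℤ) * b + c))) ^ 2)
        ≤ x ^ 2 / Real.log x ^ C

/-- READ-BACK: the crux is literally `DilatedTableChowlaFor λ`. -/
theorem dilatedTableChowlaFor_liouville_iff :
    DilatedTableChowlaFor (fun n => (ArithmeticFunction.liouville n : ℝ)) ↔ DilatedTableChowla :=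
  Iff.rfl

/-- READ-BACK: `TableChowla` is literally `TableChowlaFor λ`. -/
theorem tableChowlaFor_liouville_iff :
    TableChowlaFor (fun n => (ArithmeticFunction.liouville n : ℝ)) ↔ TableChowla :=
  Iff.rfl

/-- The generic fourth moment is a sum of squares. -/
theorem FF_nonneg (f : ℕ → ℝ) (c : ℤ) (x A : ℝ) (q u v : ℕ) : 0 ≤ FF f c x A q u v :=
  Finset.sum_nonneg fun _ _ => Finset.sum_nonneg fun _ _ => sq_nonneg _

/-- The generic `q = 1` block is the generic plain table. -/
theorem FF_one_eq_table (f : ℕ → ℝ) (c : ℤ) (x A : ℝ) (u v : ℕ) :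
    FF f c x A 1 u v = ∑ a ∈ Finset.Ioc ⌊A⌋₊ ⌊2 * A⌋₊, ∑ a' ∈ Finset.Ioc ⌊A⌋₊ ⌊2 * A⌋₊,
      (∑ b ∈ Finset.Icc 1 ⌊x / A⌋₊, f (Int.toNat ((a : ℤ) * b + c)) * f (Int.toNat ((a' : ℤ) * b + c))) ^ 2 := by
  unfold FF SF
  rw [rows_one, cols_one]

/-- The generic `q = 1` block minorises the generic left-hand side (`x ≥ 1`). -/
theorem FF_one_le_lhsF (f : ℕ → ℝ) (c : ℤ) {δ x : ℝ} (hδ : 0 ≤ δ) (hx : 1 ≤ x) (A : ℝ)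
    (u v : ℕ → ℕ) : FF f c x A 1 (u 1) (v 1) ≤ lhsF f c δ x A u v := by
  have h : (1 : ℕ) ≤ ⌊x ^ (δ / 2)⌋₊ := by
    apply Nat.le_floor
    simpa using Real.one_le_rpow hx (by linarith : 0 ≤ δ / 2)
  unfold lhsF
  have := Finset.single_le_sum (f := fun q : ℕ => (q : ℝ) ^ 3 * FF f c x A q (u q) (v q))
    (fun q _ => mul_nonneg (by positivity) (FF_nonneg f c x A q (u q) (v q))) (Finset.mem_Icc.2 ⟨le_rfl, h⟩)
  simpa using this

/-- Generic `q = 1` slice. -/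
theorem dilatedFor_imp_tableFor (f : ℕ → ℝ) (h : DilatedTableChowlaFor f) : TableChowlaFor f := by
  intro c hc δ hδ hδ' C hC
  obtain ⟨x₀, hx₀⟩ := h c hc δ hδ hδ' C hC
  refine ⟨max x₀ 1, fun x hx A hA1 hA2 => ?_⟩
  have hx0 : x₀ ≤ x := le_trans (le_max_left _ _) hx
  have hx1 : (1 : ℝ) ≤ x := le_trans (le_max_right _ _) hx
  have key := hx₀ x hx0 A hA1 hA2 (fun _ => 0) (fun _ => 0)
  have h1 := FF_one_le_lhsF f c hδ.le hx1 A (fun _ => 0) (fun _ => 0)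
  rw [FF_one_eq_table] at h1
  exact h1.trans key

/-- The key pretender computation: on rows divisible by the period, the entries at shift `1`
are the constant `f 1`. -/
theorem pretender_entry {m : ℕ} {f : ℕ → ℝ} (hf : Function.Periodic f m) {a : ℕ} (hma : m ∣ a)
    (b : ℕ) : f (Int.toNat ((a : ℤ) * b + 1)) = f 1 := by
  obtain ⟨k, rfl⟩ := hma
  rw [show ((m * k : ℕ) : ℤ) * b + 1 = (((k * b) * m + 1 : ℕ) : ℤ) by push_cast; ring,
    Int.toNat_natCast, ← hf.map_mod_nat, add_comm, Nat.add_mul_mod_self_right, hf.map_mod_nat]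

/-- (d) For every `m`-periodic `f` with `f 1 = 1`, `TableChowlaFor f` is FALSE
(witness `c = 1`, `δ = 1/12`, `C = 1`, `x = N²⁴` with `m ∣ N` and `log N ≥ m² log 2`). -/
theorem not_tableChowlaFor_periodic {m : ℕ} (hm : 1 ≤ m) {f : ℕ → ℝ} (hf : Function.Periodic f m)
    (h1 : f 1 = 1) : ¬ TableChowlaFor f := by
  intro h
  obtain ⟨x₀, hx₀⟩ := h 1 one_ne_zero (1 / 12) (by norm_num) le_rfl 1 one_pos
  -- the scale: N = m * K with K ≥ max x₀ 2 + 2^(m²)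
  obtain ⟨K₀, hK₀⟩ := exists_nat_ge (max x₀ 2)
  set K : ℕ := K₀ + 2 ^ (m ^ 2) with hK
  set N : ℕ := m * K with hN
  have hK2 : 2 ≤ K := by
    have : (2 : ℝ) ≤ K₀ := le_trans (le_max_right _ _) hK₀
    have : 2 ≤ K₀ := by exact_mod_cast this
    have : 1 ≤ 2 ^ (m ^ 2) := Nat.one_le_two_pow
    omega
  have hKN : K ≤ N := by rw [hN]; exact Nat.le_mul_of_pos_left K (by omega)
  have hN2 : 2 ≤ N := hK2.trans hKN
  have hN1 : 1 ≤ N := by omega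
  have hN0 : N ≠ 0 := by omega
  have hNpos : (0 : ℝ) < N := by exact_mod_cast (by omega : 0 < N)
  have hxN : x₀ ≤ ((N : ℝ)) ^ 24 := by
    have h1 : x₀ ≤ K₀ := le_trans (le_max_left _ _) hK₀
    have h2 : (K₀ : ℝ) ≤ K := by rw [hK]; push_cast; linarith [pow_nonneg (by norm_num : (0:ℝ) ≤ 2) (m ^ 2)]
    have h3 : (K : ℝ) ≤ N := by exact_mod_cast hKN
    exact h1.trans (h2.trans (h3.trans (self_le_pow24 hN1)))
  set x : ℝ := ((N : ℝ)) ^ 24 with hx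
  have hA1 : x ^ (1 / 12 : ℝ) ≤ (N : ℝ) ^ 2 := (pow24_rpow_eq_pow N (k := 2) (by norm_num)).le
  have hA2 : ((N : ℝ)) ^ 2 ≤ x ^ (1 / 3 + 1 / 12 : ℝ) := by
    rw [hx, pow24_rpow_eq_pow N (k := 10) (by norm_num)]
    exact pow_le_pow_right₀ (by exact_mod_cast hN1) (by norm_num)
  have key := hx₀ x hxN ((N : ℝ) ^ 2) hA1 hA2
  rw [floor_natCast_pow, floor_two_mul_natCast_pow, hx, pow24_div_pow N hN0 (by norm_num),
    floor_natCast_pow] at key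
  -- restrict both row sums to the multiples of m
  set R : Finset ℕ := (Finset.Ioc (N ^ 2) (2 * N ^ 2)).filter (fun a : ℕ => a ≡ 0 [MOD m]) with hR
  have hRsub : R ⊆ Finset.Ioc (N ^ 2) (2 * N ^ 2) := Finset.filter_subset _ _
  have hinner : ∀ a ∈ R, ∀ a' ∈ R,
      (∑ b ∈ Finset.Icc 1 (N ^ (24 - 2)),
        f (Int.toNat ((a : ℤ) * b + 1)) * f (Int.toNat ((a' : ℤ) * b + 1))) ^ 2
        = ((N ^ 22 : ℕ) : ℝ) ^ 2 := by
    intro a ha a' ha'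
    have hma : m ∣ a := (Nat.modEq_zero_iff_dvd).1 (Finset.mem_filter.1 ha).2
    have hma' : m ∣ a' := (Nat.modEq_zero_iff_dvd).1 (Finset.mem_filter.1 ha').2
    rw [Finset.sum_congr rfl fun b _ => by rw [pretender_entry hf hma, pretender_entry hf hma', h1]]
    simp
  have hcardR : ((N : ℝ)) ^ 2 / m - 1 ≤ (R.card : ℝ) := by
    have := (card_modEq_Ioc_bounds (N ^ 2) (2 * N ^ 2) m 0 (by omega) (by omega)).1
    rw [← hR] at this
    push_cast at this
    have e : ((2 : ℝ) * (N : ℝ) ^ 2 - (N : ℝ) ^ 2) / m = (N : ℝ) ^ 2 / m := by ring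
    linarith [e.symm.le, e.le]
  have hmpos : (0 : ℝ) < m := by exact_mod_cast hm
  have hcardR' : ((N : ℝ)) ^ 2 / (2 * m) ≤ (R.card : ℝ) := by
    -- N²/m = m K² ≥ 2
    have hbig : (2 : ℝ) ≤ (N : ℝ) ^ 2 / m := by
      rw [le_div_iff₀ hmpos, hN]; push_cast
      have hK2' : (2 : ℝ) ≤ K := by exact_mod_cast hK2
      have hm1 : (1 : ℝ) ≤ m := by exact_mod_cast hm
      have hm0 : (0 : ℝ) ≤ m := by linarith
      have h1 : (2 : ℝ) * m ≤ m * K := by nlinarith [mul_le_mul_of_nonneg_left hK2' hm0]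
      calc (2 : ℝ) * m ≤ 4 * (m : ℝ) ^ 2 := by nlinarith
        _ = (2 * (m : ℝ)) ^ 2 := by ring
        _ ≤ ((m : ℝ) * K) ^ 2 := by gcongr
    have e : (N : ℝ) ^ 2 / (2 * m) = ((N : ℝ) ^ 2 / m) / 2 := by field_simp
    rw [e]; linarith
  have hlow : ((N : ℝ) ^ 2 / (2 * m)) ^ 2 * ((N : ℝ) ^ 22) ^ 2 ≤
      ∑ a ∈ Finset.Ioc (N ^ 2) (2 * N ^ 2), ∑ a' ∈ Finset.Ioc (N ^ 2) (2 * N ^ 2),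
        (∑ b ∈ Finset.Icc 1 (N ^ (24 - 2)),
          f (Int.toNat ((a : ℤ) * b + 1)) * f (Int.toNat ((a' : ℤ) * b + 1))) ^ 2 := by
    calc ((N : ℝ) ^ 2 / (2 * m)) ^ 2 * ((N : ℝ) ^ 22) ^ 2
          ≤ (R.card : ℝ) ^ 2 * ((N : ℝ) ^ 22) ^ 2 := by gcongr
      _ = ∑ a ∈ R, ∑ a' ∈ R, ((N ^ 22 : ℕ) : ℝ) ^ 2 := by simp; ring
      _ = ∑ a ∈ R, ∑ a' ∈ R, (∑ b ∈ Finset.Icc 1 (N ^ (24 - 2)),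
            f (Int.toNat ((a : ℤ) * b + 1)) * f (Int.toNat ((a' : ℤ) * b + 1))) ^ 2 := by
          refine Finset.sum_congr rfl fun a ha => Finset.sum_congr rfl fun a' ha' => ?_
          rw [hinner a ha a' ha']
      _ ≤ ∑ a ∈ R, ∑ a' ∈ Finset.Ioc (N ^ 2) (2 * N ^ 2), (∑ b ∈ Finset.Icc 1 (N ^ (24 - 2)),
            f (Int.toNat ((a : ℤ) * b + 1)) * f (Int.toNat ((a' : ℤ) * b + 1))) ^ 2 := by
          refine Finset.sum_le_sum fun a _ => ?_
          exact Finset.sum_le_sum_of_subset_of_nonneg hRsub fun _ _ _ => sq_nonneg _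
      _ ≤ _ := Finset.sum_le_sum_of_subset_of_nonneg hRsub fun _ _ _ =>
            Finset.sum_nonneg fun _ _ => sq_nonneg _
  -- compare with the right-hand side: x²/log x = N⁴⁸/(24 log N) and log N ≥ m² log 2
  have hlogN : (m : ℝ) ^ 2 * Real.log 2 ≤ Real.log N := by
    have h2K : (2 : ℝ) ^ (m ^ 2) ≤ K := by rw [hK]; push_cast; linarith [(Nat.cast_nonneg K₀ : (0:ℝ) ≤ K₀)]
    have hKN' : (K : ℝ) ≤ N := by exact_mod_cast hKN
    calc (m : ℝ) ^ 2 * Real.log 2 = Real.log ((2 : ℝ) ^ (m ^ 2)) := by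
            rw [Real.log_pow]; push_cast; ring
      _ ≤ Real.log N := Real.log_le_log (by positivity) (h2K.trans hKN')
  have hlog2 := Real.log_two_gt_d9
  have hrhs : (((N : ℝ)) ^ 24) ^ 2 / Real.log (((N : ℝ)) ^ 24) ^ (1 : ℝ)
      < ((N : ℝ) ^ 2 / (2 * m)) ^ 2 * ((N : ℝ) ^ 22) ^ 2 := by
    rw [Real.rpow_one, log_pow24]
    have hpos48 : (0 : ℝ) < (N : ℝ) ^ 48 := by positivity
    have e1 : (((N : ℝ)) ^ 24) ^ 2 = (N : ℝ) ^ 48 := by ring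
    have e2 : ((N : ℝ) ^ 2 / (2 * m)) ^ 2 * ((N : ℝ) ^ 22) ^ 2 = (N : ℝ) ^ 48 / (4 * m ^ 2) := by
      field_simp; ring
    rw [e1, e2]
    apply div_lt_div_of_pos_left hpos48 (by positivity)
    nlinarith
  rw [← hx] at hrhs
  have : x = ((N : ℝ)) ^ 24 := hx
  linarith [key, hlow, hrhs]

/-- … hence `DilatedTableChowlaFor f` is false for every such `f` as well. -/
theorem not_dilatedTableChowlaFor_periodic {m : ℕ} (hm : 1 ≤ m) {f : ℕ → ℝ}
    (hf : Function.Periodic f m) (h1 : f 1 = 1) : ¬ DilatedTableChowlaFor f :=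
  fun h => not_tableChowlaFor_periodic hm hf h1 (dilatedFor_imp_tableFor f h)

/-- Selberg's ghost / the principal character: the constant function `1`. -/
theorem not_dilatedTableChowlaFor_one : ¬ DilatedTableChowlaFor (fun _ => 1) :=
  not_dilatedTableChowlaFor_periodic (m := 1) le_rfl (fun _ => rfl) rfl

/-- The non-principal character mod 3 as a `3`-periodic `±1, 0` pattern. -/
def chi3 (n : ℕ) : ℝ := if n % 3 = 1 then 1 else if n % 3 = 2 then -1 else 0

/-- `χ₃` is `3`-periodic. -/
theorem chi3_periodic : Function.Periodic chi3 3 := fun n => by simp [chi3]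

/-- The crux shape FAILS for the character `χ₃`. -/
theorem not_dilatedTableChowlaFor_chi3 : ¬ DilatedTableChowlaFor chi3 :=
  not_dilatedTableChowlaFor_periodic (m := 3) (by norm_num) chi3_periodic (by simp [chi3])

/-- The non-principal character mod 4 (the "λ ≈ χ₋₄" Siegel-type model). -/
def chi4 (n : ℕ) : ℝ := if n % 4 = 1 then 1 else if n % 4 = 3 then -1 else 0

/-- `χ₄` is `4`-periodic. -/
theorem chi4_periodic : Function.Periodic chi4 4 := fun n => by simp [chi4]

/-- The crux shape FAILS for the character `χ₄`. -/
theorem not_dilatedTableChowlaFor_chi4 : ¬ DilatedTableChowlaFor chi4 :=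
  not_dilatedTableChowlaFor_periodic (m := 4) (by norm_num) chi4_periodic (by simp [chi4])

end Summit.Parity.GeneralizedHardyLittlewood.Theorems.DilatedTableChowla.Negative
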